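import Summits.QuantumFields.YangMills.Theorems.LuscherReductionOneSiteLevelsGnPullback

/-!
# The one-site configuration measure in the gnomonic chart
# (support module for the registered stub `stub_absLower` of crux `OneSiteLevels`, route `LuscherReduction`,
# item stmt-QuantumFields-20007; fleet seat prover ym-luscher-20007-p2)

Normalised Haar measure on `SU(2)` is, in the gnomonic coordinate `v = u/u₀`, the image of the density
`w(v) = (2π²)⁻¹(1+|v|²)⁻²` on `ℝ³` under the two hemisphere charts `v ↦ ±P(1,v)` (tree:
`SU2HaarChart.lintegral_haarProbability_su2_gnomonic`).  This module packages that formula as MEASURE identities and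
multiplies it over the three links of the one-site lattice:

* `haarProbability_su2_eq_gnomonic`: `Haar = ν ∘ P(1,·)⁻¹ + ν ∘ (−P(1,·))⁻¹`, `ν = w · Lebesgue(ℝ³)`;
* `configMeasure_su2_one_eq_sum_gnChart`: for every scale `μ > 0`,
  `configMeasure SU2 1 = Σ_{σ : Fin 3 → Bool} (gnDensity μ · Lebesgue(ZM)) ∘ (gnChart μ σ)⁻¹`,
  `gnDensity μ y = μ⁹ ∏_i w(μ y_i)` — the a-priori measure of the one-site model as a sum over the `8` hemisphere patterns
  of push-forwards of an explicit density on Lüscher's zero-mode space `ZM = ℝ⁹` (currying `ℝ⁹ ≅ (links → ℝ³)` by the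
  tree's `LatticeMaxwell.volume_preserving_curry`, products of densities by `GaussianToolkit.pi_withDensity`);
* `lintegral_configMeasure_eq_sum_gnChart` / `integral_configMeasure_eq_sum_gnChart`: the corresponding change-of-variables
  formulas for `ℝ≥0∞`-valued measurable and for bounded measurable real integrands.

## WHAT THIS IS NOT
Pure measure-theoretic plumbing ([folklore]); NOT the stub, NOT THE CLAY GAP.  Sorry-free, no named fact.
-/

set_option autoImplicit false

noncomputable section

open MeasureTheory Filter Topology Real
open scoped Matrix Quaternion ENNReal
open Literature.MathematicalPhysics.QuantumFieldTheory
open Literature.MathematicalPhysics.QuantumLattice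
open Literature.Analysis.OperatorTheory.YMMatrixModel
open Literature.MathematicalPhysics.QuantumFieldTheory.Balaban1983to89.T4CubeChartGnomonic (gnoPoint gnoWeight
  gnoWeight_pos gnoWeight_le measurable_gnoWeight continuous_gnoPoint)

namespace Summit.QuantumFields.YangMills.Theorems.FemtoTransferGap

/-! ### §1. Haar on `SU(2)` as a sum of two push-forwards -/

/-- The gnomonic density measure on `ℝ³`: `ν = (2π²)⁻¹(1+|v|²)⁻² dv`. [folklore] -/
def gnoDensityMeasure : Measure (Fin 3 → ℝ) :=
  (volume : Measure (Fin 3 → ℝ)).withDensity fun v => ENNReal.ofReal (gnoWeight v)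

/-- **Haar on `SU(2)` in the gnomonic chart, as measures**: `Haar = ν∘P(1,·)⁻¹ + ν∘(−P(1,·))⁻¹`. [folklore] -/
theorem haarProbability_su2_eq_gnomonic :
    haarProbability SU2 = gnoDensityMeasure.map gnoPoint + gnoDensityMeasure.map (fun v => negOne * gnoPoint v) := by
  haveI := secondCountableTopology_su2
  have hP : Measurable gnoPoint := continuous_gnoPoint.measurable
  have hN : Measurable fun v : Fin 3 → ℝ => negOne * gnoPoint v := (continuous_const.mul continuous_gnoPoint).measurable
  refine Measure.ext fun s hs => ?_
  have hmeasP : Measurable ((gnoPoint ⁻¹' s).indicator fun a : Fin 3 → ℝ => ENNReal.ofReal (gnoWeight a)) :=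
    measurable_gnoWeight.ennreal_ofReal.indicator (hP hs)
  rw [← lintegral_indicator_one hs, lintegral_haarProbability_su2_gnomonic _ (measurable_one.indicator hs),
    Measure.add_apply, Measure.map_apply hP hs, Measure.map_apply hN hs, gnoDensityMeasure,
    withDensity_apply _ (hP hs), withDensity_apply _ (hN hs), ← lintegral_indicator (hP hs),
    ← lintegral_indicator (hN hs), ← lintegral_add_left hmeasP, ← lintegral_const_mul' _ _ ENNReal.ofReal_ne_top]
  refine lintegral_congr fun v => ?_
  have hw : ENNReal.ofReal (1 / (2 * Real.pi ^ 2)) * ENNReal.ofReal (((1 + ∑ i, v i ^ 2)⁻¹) ^ 2) =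
      ENNReal.ofReal (gnoWeight v) := by
    rw [← ENNReal.ofReal_mul (by positivity), gnoWeight, one_div]
  rw [show quatToSU2 (gnomonicQuat v) = gnoPoint v from rfl, quatToSU2_neg_gnomonicQuat, add_mul, mul_add]
  congr 1
  · by_cases hv : gnoPoint v ∈ s
    · rw [Set.indicator_of_mem hv, Set.indicator_of_mem (show v ∈ gnoPoint ⁻¹' s from hv), Pi.one_apply, one_mul, hw]
    · rw [Set.indicator_of_notMem hv, Set.indicator_of_notMem (show v ∉ gnoPoint ⁻¹' s from hv), zero_mul, mul_zero]
  · by_cases hv : negOne * gnoPoint v ∈ s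
    · rw [Set.indicator_of_mem hv, Set.indicator_of_mem (show v ∈ (fun v => negOne * gnoPoint v) ⁻¹' s from hv),
        Pi.one_apply, one_mul, hw]
    · rw [Set.indicator_of_notMem hv, Set.indicator_of_notMem (show v ∉ (fun v => negOne * gnoPoint v) ⁻¹' s from hv),
        zero_mul, mul_zero]

/-- The gnomonic density measure is finite (its two images add up to a probability measure). [folklore] -/
theorem isFiniteMeasure_gnoDensityMeasure : IsFiniteMeasure gnoDensityMeasure := by
  refine ⟨?_⟩
  have h : gnoDensityMeasure.map gnoPoint Set.univ ≤ haarProbability SU2 Set.univ := by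
    rw [haarProbability_su2_eq_gnomonic, Measure.add_apply]
    exact le_self_add
  rw [Measure.map_apply continuous_gnoPoint.measurable MeasurableSet.univ, Set.preimage_univ] at h
  exact lt_of_le_of_lt h (measure_lt_top _ _)

/-- The hemisphere chart `v ↦ hemi b · P(1,v)`. [folklore] -/
def hemiChart (b : Bool) (v : Fin 3 → ℝ) : SU2 := hemi b * gnoPoint v

/-- The hemisphere charts are measurable. [folklore] -/
theorem measurable_hemiChart (b : Bool) : Measurable (hemiChart b) := by
  haveI := secondCountableTopology_su2
  exact (continuous_const.mul continuous_gnoPoint).measurable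

/-- Haar as a sum over the two hemispheres: `Haar = Σ_b ν ∘ (hemiChart b)⁻¹`. [folklore] -/
theorem haarProbability_su2_eq_sum_hemiChart :
    haarProbability SU2 = gnoDensityMeasure.map (hemiChart false) + gnoDensityMeasure.map (hemiChart true) := by
  rw [haarProbability_su2_eq_gnomonic]
  congr 1
  congr 1
  funext v
  simp [hemiChart, hemi]

/-! ### §2. Products: the one-site configuration measure as a sum over the `8` hemisphere patterns -/

/-- Binomial expansion of a finite product measure: `⊗_e (m₀ + m₁) = Σ_{z : E → Bool} ⊗_e m_{z e}`. [folklore] -/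
theorem pi_add_eq_sum_pi {E α : Type*} [Fintype E] [MeasurableSpace α] (m : Bool → Measure α)
    [∀ b, IsFiniteMeasure (m b)] :
    Measure.pi (fun _ : E => m false + m true) = Measure.sum fun z : E → Bool => Measure.pi fun e => m (z e) := by
  classical
  refine Measure.pi_eq fun s hs => ?_
  rw [Measure.sum_apply _ (MeasurableSet.univ_pi hs), tsum_fintype]
  simp_rw [Measure.pi_pi, Measure.add_apply]
  have h := Finset.prod_univ_sum (fun _ : E => (Finset.univ : Finset Bool)) fun e b => m b (s e)
  simp only [Fintype.piFinset_univ] at h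
  rw [← h]
  refine Finset.prod_congr rfl fun e _ => ?_
  rw [Fintype.sum_bool, add_comm]

/-- The pattern chart on `(E → ℝ³)`: link `e` is `hemiChart (z e)` of coordinate block `e`. [folklore] -/
def patternChart (z : Edge 3 1 → Bool) (w : Edge 3 1 → Fin 3 → ℝ) : Cfg := fun e => hemiChart (z e) (w e)

/-- **The one-site a-priori measure over `(links → ℝ³)`**: `σ^{⊗3} = Σ_z (∏_e w(w_e) dw) ∘ (patternChart z)⁻¹`. [folklore] -/
theorem configMeasure_su2_one_eq_sum_patternChart :
    configMeasure SU2 1 = Measure.sum fun z : Edge 3 1 → Bool =>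
      (((volume : Measure (Edge 3 1 → Fin 3 → ℝ)).withDensity fun w => ∏ e, ENNReal.ofReal (gnoWeight (w e))).map
        (patternChart z)) := by
  haveI := isFiniteMeasure_gnoDensityMeasure
  unfold configMeasure
  rw [haarProbability_su2_eq_sum_hemiChart, pi_add_eq_sum_pi (fun b => gnoDensityMeasure.map (hemiChart b))]
  congr 1
  funext z
  have hpi : (Measure.pi fun _ : Edge 3 1 => gnoDensityMeasure).map (fun w e => hemiChart (z e) (w e)) =
      Measure.pi fun e => gnoDensityMeasure.map (hemiChart (z e)) :=
    Measure.pi_map_pi fun e => (measurable_hemiChart (z e)).aemeasurable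
  rw [← hpi]
  have hdens : (Measure.pi fun _ : Edge 3 1 => gnoDensityMeasure) =
      (volume : Measure (Edge 3 1 → Fin 3 → ℝ)).withDensity fun w => ∏ e, ENNReal.ofReal (gnoWeight (w e)) := by
    rw [gnoDensityMeasure, volume_pi]
    exact GaussianToolkit.pi_withDensity (fun _ : Edge 3 1 => (volume : Measure (Fin 3 → ℝ)))
      (fun _ => fun v => ENNReal.ofReal (gnoWeight v)) fun _ => ENNReal.measurable_ofReal.comp measurable_gnoWeight
  rw [hdens]
  rfl

/-! ### §3. Transport to the zero-mode space `ZM = ℝ⁹` at scale `μ` -/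

/-- The links of the one-site lattice are indexed by their direction. [folklore] -/
def edgeFin : Edge 3 1 ≃ Fin 3 where
  toFun e := e.2
  invFun i := edgeOf i
  left_inv e := edgeOf_snd e
  right_inv _ := rfl

/-- The scale-`μ` transport `ZM → (links → ℝ³)`, `y ↦ (e ↦ μ · y_{(e.2,·)})`, as a measurable equivalence (`μ ≠ 0`). [folklore] -/
def gnTransport (μ : ℝ) (hμ : μ ≠ 0) : ZM ≃ᵐ (Edge 3 1 → Fin 3 → ℝ) where
  toFun y e a := μ * y (e.2, a)
  invFun w := WithLp.toLp 2 fun p : Fin 3 × Fin 3 => w (edgeOf p.1) p.2 / μ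
  left_inv y := by
    ext p
    simp only [edgeOf]
    field_simp
  right_inv w := by
    funext e a
    simp only
    rw [edgeOf_snd]
    field_simp
  measurable_toFun := by
    refine measurable_pi_lambda _ fun e => measurable_pi_lambda _ fun a => ?_
    exact measurable_const.mul ((measurable_pi_apply (e.2, a)).comp (PiLp.continuous_ofLp 2 _).measurable)
  measurable_invFun := by
    refine (PiLp.continuous_toLp 2 _).measurable.comp (measurable_pi_lambda _ fun p => ?_)
    have h1 : Measurable fun w : Edge 3 1 → Fin 3 → ℝ => w (edgeOf p.1) := measurable_pi_apply (edgeOf p.1)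
    have h2 : Measurable fun w : Edge 3 1 → Fin 3 → ℝ => w (edgeOf p.1) p.2 := (measurable_pi_apply p.2).comp h1
    exact h2.div_const μ

/-- `gnTransport μ` applied. [folklore] -/
@[simp] theorem gnTransport_apply (μ : ℝ) (hμ : μ ≠ 0) (y : ZM) (e : Edge 3 1) (a : Fin 3) :
    gnTransport μ hμ y e a = μ * y (e.2, a) := rfl

/-- The unit transport is the composition `ZM ≅ (Fin 3 × Fin 3 → ℝ) ≅ (Fin 3 → ℝ³) ≅ (links → ℝ³)`. [folklore] -/
theorem gnTransport_one_eq :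
    ⇑(gnTransport 1 one_ne_zero) =
      ⇑((MeasurableEquiv.piCongrLeft (fun _ : Fin 3 => Fin 3 → ℝ) edgeFin).symm) ∘
        ⇑(MeasurableEquiv.curry (Fin 3) (Fin 3) ℝ) ∘ ⇑(MeasurableEquiv.toLp 2 (Fin 3 × Fin 3 → ℝ)).symm := by
  funext y
  funext e a
  rw [gnTransport_apply, one_mul]
  rfl

/-- The unit transport preserves Lebesgue measure. [folklore] -/
theorem measurePreserving_gnTransport_one :
    MeasurePreserving (gnTransport 1 one_ne_zero) (volume : Measure ZM) (volume : Measure (Edge 3 1 → Fin 3 → ℝ)) := by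
  have h1 : MeasurePreserving (MeasurableEquiv.toLp 2 (Fin 3 × Fin 3 → ℝ)).symm (volume : Measure ZM) volume :=
    EuclideanSpace.volume_preserving_symm_measurableEquiv_toLp (Fin 3 × Fin 3)
  have h2 := LatticeMaxwell.volume_preserving_curry (Fin 3) (Fin 3)
  have h3 := (volume_measurePreserving_piCongrLeft (fun _ : Fin 3 => Fin 3 → ℝ) edgeFin).symm
  have h := (h3.comp h2).comp h1
  refine ⟨(gnTransport 1 one_ne_zero).measurable, ?_⟩
  have hf : ⇑(gnTransport 1 one_ne_zero) = ⇑((MeasurableEquiv.piCongrLeft (fun _ : Fin 3 => Fin 3 → ℝ) edgeFin).symm) ∘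
      (⇑(MeasurableEquiv.curry (Fin 3) (Fin 3) ℝ) ∘ ⇑(MeasurableEquiv.toLp 2 (Fin 3 × Fin 3 → ℝ)).symm) := gnTransport_one_eq
  rw [hf]
  exact h.map_eq

/-- The scale-`μ` transport is the unit transport after the homothety `y ↦ μ • y`. [folklore] -/
theorem gnTransport_eq_comp_smul (μ : ℝ) (hμ : μ ≠ 0) :
    ⇑(gnTransport μ hμ) = ⇑(gnTransport 1 one_ne_zero) ∘ fun y : ZM => μ • y := by
  funext y; funext e a
  simp [gnTransport_apply]

/-- **Push-forward of Lebesgue measure under the scale-`μ` transport**: `(gnTransport μ)_* dy = |μ⁹|⁻¹ · dw`. [folklore] -/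
theorem map_gnTransport_volume (μ : ℝ) (hμ : μ ≠ 0) :
    (volume : Measure ZM).map (gnTransport μ hμ) =
      ENNReal.ofReal (|(μ ^ 9)⁻¹|) • (volume : Measure (Edge 3 1 → Fin 3 → ℝ)) := by
  rw [gnTransport_eq_comp_smul μ hμ, ← Measure.map_map (gnTransport 1 one_ne_zero).measurable (measurable_const_smul μ),
    Measure.map_addHaar_smul volume hμ, Measure.map_smul, measurePreserving_gnTransport_one.map_eq]
  congr 2
  rw [finrank_euclideanSpace, Fintype.card_prod, Fintype.card_fin, abs_inv]

/-- The gnomonic density on the zero-mode space at scale `μ`: `μ⁹ ∏_i w(μ y_i)`. [folklore] -/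
def gnDensity (μ : ℝ) (y : ZM) : ℝ≥0∞ :=
  ENNReal.ofReal (μ ^ 9 * ∏ i : Fin 3, gnoWeight (fun a => μ * y (i, a)))

/-- The real density behind `gnDensity`. [folklore] -/
def gnDensityReal (μ : ℝ) (y : ZM) : ℝ := μ ^ 9 * ∏ i : Fin 3, gnoWeight (fun a => μ * y (i, a))

/-- `gnDensity = ofReal ∘ gnDensityReal`. [folklore] -/
theorem gnDensity_eq (μ : ℝ) (y : ZM) : gnDensity μ y = ENNReal.ofReal (gnDensityReal μ y) := rfl

/-- The real density is positive for `μ > 0`. [folklore] -/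
theorem gnDensityReal_pos {μ : ℝ} (hμ : 0 < μ) (y : ZM) : 0 < gnDensityReal μ y :=
  mul_pos (pow_pos hμ 9) (Finset.prod_pos fun _ _ => gnoWeight_pos _)

/-- The real density is at most `μ⁹ (2π²)⁻³`. [folklore] -/
theorem gnDensityReal_le {μ : ℝ} (hμ : 0 < μ) (y : ZM) : gnDensityReal μ y ≤ μ ^ 9 * ((2 * π ^ 2)⁻¹) ^ 3 := by
  unfold gnDensityReal
  refine mul_le_mul_of_nonneg_left ?_ (pow_pos hμ 9).le
  calc ∏ i : Fin 3, gnoWeight (fun a => μ * y (i, a)) ≤ ∏ _ : Fin 3, (2 * π ^ 2)⁻¹ :=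
        Finset.prod_le_prod (fun i _ => (gnoWeight_pos _).le) fun i _ => gnoWeight_le _
    _ = ((2 * π ^ 2)⁻¹) ^ 3 := by simp

/-- `gnDensityReal μ` is measurable. [folklore] -/
theorem measurable_gnDensityReal (μ : ℝ) : Measurable (gnDensityReal μ) := by
  unfold gnDensityReal
  refine measurable_const.mul (Finset.measurable_prod _ fun i _ => measurable_gnoWeight.comp ?_)
  exact measurable_pi_lambda _ fun a => measurable_const.mul ((measurable_pi_apply (i, a)).comp (PiLp.continuous_ofLp 2 _).measurable)

/-- `gnDensity μ` is measurable. [folklore] -/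
theorem measurable_gnDensity (μ : ℝ) : Measurable (gnDensity μ) :=
  ENNReal.measurable_ofReal.comp (measurable_gnDensityReal μ)

/-- The pattern chart after the transport is the sign-pattern gnomonic chart `gnChart`. [folklore] -/
theorem patternChart_gnTransport (μ : ℝ) (hμ : μ ≠ 0) (z : Edge 3 1 → Bool) (y : ZM) :
    patternChart z (gnTransport μ hμ y) = gnChart μ (z ∘ edgeOf) y := by
  funext e
  show hemi (z e) * gnoPoint (fun a => μ * y (e.2, a)) = hemi (z (edgeOf e.2)) * gnoPoint (fun a => μ * y (e.2, a))
  rw [edgeOf_snd]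

/-- The product density after the transport is `gnDensity μ` divided by `μ⁹`. [folklore] -/
theorem prod_gnoWeight_gnTransport (μ : ℝ) (hμ : μ ≠ 0) (y : ZM) :
    (∏ e : Edge 3 1, ENNReal.ofReal (gnoWeight (gnTransport μ hμ y e))) =
      ENNReal.ofReal (∏ i : Fin 3, gnoWeight (fun a => μ * y (i, a))) := by
  rw [← ENNReal.ofReal_prod_of_nonneg fun e _ => (gnoWeight_pos _).le]
  congr 1

/-- **The one-site a-priori measure in the gnomonic chart at scale `μ > 0`**:
`configMeasure SU2 1 = Σ_{σ : Fin 3 → Bool} (gnDensity μ · Lebesgue(ZM)) ∘ (gnChart μ σ)⁻¹`. [folklore] -/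
theorem configMeasure_su2_one_eq_sum_gnChart {μ : ℝ} (hμ : 0 < μ) :
    configMeasure SU2 1 = Measure.sum fun σ : Fin 3 → Bool =>
      ((volume : Measure ZM).withDensity (gnDensity μ)).map (gnChart μ σ) := by
  have hμ0 : μ ≠ 0 := hμ.ne'
  rw [configMeasure_su2_one_eq_sum_patternChart]
  -- reindex the patterns by `σ = z ∘ edgeOf`
  let eqv : (Fin 3 → Bool) ≃ (Edge 3 1 → Bool) := edgeFin.symm.arrowCongr (Equiv.refl Bool)
  rw [← Measure.sum_comp_equiv eqv]
  congr 1
  funext σ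
  simp only [Function.comp_apply]
  -- the transported density
  have hT := map_gnTransport_volume μ hμ0
  have hvol : (volume : Measure (Edge 3 1 → Fin 3 → ℝ)) =
      ((ENNReal.ofReal (μ ^ 9) • (volume : Measure ZM))).map (gnTransport μ hμ0) := by
    rw [Measure.map_smul, hT, smul_smul, ← ENNReal.ofReal_mul (by positivity), abs_of_pos (by positivity),
      mul_inv_cancel₀ (by positivity), ENNReal.ofReal_one, one_smul]
  have hPat : Measurable (patternChart (eqv σ)) := by
    haveI := secondCountableTopology_su2
    exact measurable_pi_lambda _ fun e => (measurable_hemiChart _).comp (measurable_pi_apply e)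
  set T := gnTransport μ hμ0 with hTdef
  have hρ : (fun w : Edge 3 1 → Fin 3 → ℝ => ∏ e, ENNReal.ofReal (gnoWeight (w e))) =
      (fun y : ZM => ∏ e, ENNReal.ofReal (gnoWeight (T y e))) ∘ ⇑T.symm := by
    funext w
    simp only [Function.comp_apply, MeasurableEquiv.apply_symm_apply]
  rw [hvol, hρ, ← GaussianToolkit.map_withDensity_equiv, Measure.map_map hPat T.measurable]
  have hchart : patternChart (eqv σ) ∘ ⇑T = gnChart μ σ := by
    funext y
    rw [Function.comp_apply, hTdef, patternChart_gnTransport]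
    rfl
  rw [hchart]
  congr 1
  rw [withDensity_smul_measure, ← withDensity_smul' _ _ ENNReal.ofReal_ne_top]
  congr 1
  funext y
  rw [Pi.smul_apply, smul_eq_mul, hTdef, prod_gnoWeight_gnTransport, gnDensity,
    ← ENNReal.ofReal_mul (by positivity)]

/-! ### §4. Change-of-variables formulas -/

/-- **Lower-integral change of variables**: for measurable `g ≥ 0` on the one-site configurations and `μ > 0`,
`∫ g dσ^{⊗3} = Σ_σ ∫_{ℝ⁹} g(gnChart μ σ y) · gnDensity μ y dy`. [folklore] -/
theorem lintegral_configMeasure_eq_sum_gnChart {μ : ℝ} (hμ : 0 < μ) {g : Cfg → ℝ≥0∞} (hg : Measurable g) :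
    ∫⁻ U, g U ∂(configMeasure SU2 1) = ∑ σ : Fin 3 → Bool, ∫⁻ y, g (gnChart μ σ y) * gnDensity μ y ∂volume := by
  rw [configMeasure_su2_one_eq_sum_gnChart hμ, lintegral_sum_measure, tsum_fintype]
  refine Finset.sum_congr rfl fun σ _ => ?_
  rw [lintegral_map hg (measurable_gnChart μ σ), lintegral_withDensity_eq_lintegral_mul _ (measurable_gnDensity μ)
    (show Measurable (fun y => g (gnChart μ σ y)) from hg.comp (measurable_gnChart μ σ))]
  refine lintegral_congr fun y => ?_
  simp only [Pi.mul_apply, mul_comm]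

/-- A bounded measurable real function is integrable for the one-site a-priori (probability) measure. [folklore] -/
theorem integrable_configMeasure_of_bounded {g : Cfg → ℝ} (hg : Measurable g) (hb : ∃ C : ℝ, ∀ U, |g U| ≤ C) :
    Integrable g (configMeasure SU2 1) := by
  obtain ⟨C, hC⟩ := hb
  exact Integrable.mono' (integrable_const C) hg.aestronglyMeasurable (ae_of_all _ fun U => by
    rw [Real.norm_eq_abs]; exact hC U)

/-- **Change of variables** for bounded measurable real integrands: for `μ > 0`,
`∫ g dσ^{⊗3} = Σ_σ ∫_{ℝ⁹} gnDensityReal μ y · g(gnChart μ σ y) dy`. [folklore] -/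
theorem integral_configMeasure_eq_sum_gnChart {μ : ℝ} (hμ : 0 < μ) {g : Cfg → ℝ} (hg : Measurable g)
    (hb : ∃ C : ℝ, ∀ U, |g U| ≤ C) :
    ∫ U, g U ∂(configMeasure SU2 1) =
      ∑ σ : Fin 3 → Bool, ∫ y, gnDensityReal μ y * g (gnChart μ σ y) ∂volume := by
  have hint : Integrable g (configMeasure SU2 1) := integrable_configMeasure_of_bounded hg hb
  rw [configMeasure_su2_one_eq_sum_gnChart hμ] at hint ⊢
  rw [integral_sum_measure hint, tsum_fintype]
  refine Finset.sum_congr rfl fun σ _ => ?_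
  rw [integral_map (measurable_gnChart μ σ).aemeasurable hg.aestronglyMeasurable,
    integral_withDensity_eq_integral_toReal_smul (measurable_gnDensity μ)
      (ae_of_all _ fun y => by rw [gnDensity_eq]; exact ENNReal.ofReal_lt_top)]
  refine integral_congr_ae (ae_of_all _ fun y => ?_)
  show (gnDensity μ y).toReal • g (gnChart μ σ y) = gnDensityReal μ y * g (gnChart μ σ y)
  rw [gnDensity_eq, ENNReal.toReal_ofReal (gnDensityReal_pos hμ y).le, smul_eq_mul]

/-- **Pull-backs integrate with weight `8 · gnDensityReal`**: for a bounded measurable `G` on the zero-mode space,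
`∫ G(gnCoord μ U) dU = 8 ∫ gnDensityReal μ y · G y dy` (all `8` hemisphere patterns have the same coordinate). [folklore] -/
theorem integral_gnPullback {μ : ℝ} (hμ : 0 < μ) {G : ZM → ℝ} (hG : Measurable G) (hb : ∃ C : ℝ, ∀ x, |G x| ≤ C) :
    ∫ U, G (gnCoord μ U) ∂(configMeasure SU2 1) = 8 * ∫ y, gnDensityReal μ y * G y ∂volume := by
  have hb' : ∃ C : ℝ, ∀ U : Cfg, |G (gnCoord μ U)| ≤ C := by obtain ⟨C, hC⟩ := hb; exact ⟨C, fun U => hC _⟩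
  rw [integral_configMeasure_eq_sum_gnChart hμ (show Measurable (fun U : Cfg => G (gnCoord μ U)) from
    hG.comp (measurable_gnCoord μ)) hb']
  simp only [gnCoord_gnChart hμ.ne']
  rw [Finset.sum_const, Finset.card_univ, Fintype.card_fun, Fintype.card_bool, Fintype.card_fin, nsmul_eq_mul]
  norm_num

end Summit.QuantumFields.YangMills.Theorems.FemtoTransferGap

end
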